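import Mathlib
import Summits.Schanuel.Schanuel.Theorems.DiophantineDichotomyDefs
import HarnessLib

/-!
# Route `DiophantineDichotomy`, crux `KhovanskiiApproxTypeEv` (stmt-Schanuel-14972), line `lambert-liouville-kill`:
# stub `stub_expRationalPoint` — a non-degenerate exp-rational point `(1, x)`, `A(x) eˣ = B(x)`, is a free
# Khovanskii point

Crux `Summit.Schanuel.Schanuel.Theses.DiophantineDichotomy.KhovanskiiApproxTypeEv` (item stmt-Schanuel-14972),
certificate line `lambert-liouville-kill`, EXTENSION (lead `prover-line-stmt-Schanuel-14972-a1-0`): the general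
exp-rational certificate `notLiouville_expRational_of_ev` (skeleton
`Cruxes/KhovanskiiApproxTypeEv/Lines/lambert_liouville_kill_expRational.lean`), registered stub F1
`stub_expRationalPoint` (landed `--supports stmt-Schanuel-14972`).

If `A(x) eˣ = B(x)` with `A, B ∈ ℤ[X]` and `eˣ (A(x) + A′(x)) − B′(x) ≠ 0` (i.e. `x` is a simple zero of the
exponential polynomial `A(t) eᵗ − B(t)`), then `s = (1, x)` is a free Khovanskii point of `ℂ²`: the system
`z₀ − 1 = 0`, `A(z₁) y₁ − B(z₁) = 0` over `ℚ` has exponential Jacobian `diag(1, A′(x) y₁ − B′(x) + y₁ A(x))`.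
The bookkeeping: `A ∈ ℤ[X]` is placed in `MvPolynomial (Fin 2 ⊕ Fin 2) ℚ` as `aeval (X (inl 1)) (A.map ℤ→ℚ)`;
evaluation commutes (`Polynomial.aeval_algHom_apply`, `Polynomial.aeval_map_algebraMap`) and the partial
derivatives follow from `Derivation.map_aeval` (chain rule for derivations) and `MvPolynomial.pderiv_X`.
-/

noncomputable section

-- `Summit.Schanuel.Schanuel.…` is the mandated summit/sub-problem namespace (single-conjunct summit), hence:
set_option linter.dupNamespace false

namespace Summit.Schanuel.Schanuel.Cruxes.KhovanskiiApproxTypeEv.LambertLiouvilleKill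

open Summit.Schanuel.Schanuel.Cruxes.KhovanskiiApproxType.LwSmallHeight (IsFreeKhovanskii)
open Polynomial

/-- Evaluation of a univariate integer polynomial placed at the variable `X i` of a rational multivariate
polynomial ring: `(aeval θ) (aeval (X i) (R.map ℤ→ℚ)) = aeval (θ i) R`. [folklore] -/
theorem mvAeval_aeval_X_map {σ : Type*} (R : ℤ[X]) (i : σ) (θ : σ → ℂ) :
    MvPolynomial.aeval θ (Polynomial.aeval (MvPolynomial.X i : MvPolynomial σ ℚ)
      (R.map (Int.castRingHom ℚ))) = Polynomial.aeval (θ i) R := by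
  rw [← Polynomial.aeval_algHom_apply, MvPolynomial.aeval_X,
    show Int.castRingHom ℚ = algebraMap ℤ ℚ from rfl, Polynomial.aeval_map_algebraMap]

/-- **STUB F1.**  If `A(x) eˣ = B(x)` with `A, B ∈ ℤ[X]` and `eˣ (A(x) + A′(x)) − B′(x) ≠ 0`, then
`s = (1, x)` is a free Khovanskii point of `ℂ²`: the system `z₀ − 1 = 0`, `A(z₁) y₁ − B(z₁) = 0` over `ℚ`
has exponential Jacobian `diag(1, A′(x) y₁ − B′(x) + y₁ A(x))`, determinant `eˣ(A(x) + A′(x)) − B′(x) ≠ 0`.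
[folklore] -/
theorem stub_expRationalPoint :
    ∀ (A B : ℤ[X]) (x : ℂ), Polynomial.aeval x A * Complex.exp x = Polynomial.aeval x B →
      Complex.exp x * (Polynomial.aeval x A + Polynomial.aeval x (Polynomial.derivative A)) -
        Polynomial.aeval x (Polynomial.derivative B) ≠ 0 →
      IsFreeKhovanskii 2 ![(1 : ℂ), x] := by
  intro A B x hx hJ
  classical
  let y : MvPolynomial (Fin 2 ⊕ Fin 2) ℚ := MvPolynomial.X (Sum.inl 1)
  have hy : y = MvPolynomial.X (Sum.inl 1) := rfl
  have hpd : ∀ j, MvPolynomial.pderiv j y = MvPolynomial.pderiv j (MvPolynomial.X (Sum.inl 1)) :=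
    fun j => rfl
  set Aq : ℚ[X] := A.map (Int.castRingHom ℚ) with hAq
  set Bq : ℚ[X] := B.map (Int.castRingHom ℚ) with hBq
  have evA : ∀ θ : Fin 2 ⊕ Fin 2 → ℂ, MvPolynomial.aeval θ (Polynomial.aeval y Aq) =
      Polynomial.aeval (θ (Sum.inl 1)) A := fun θ => by rw [hy, hAq, mvAeval_aeval_X_map]
  have evB : ∀ θ : Fin 2 ⊕ Fin 2 → ℂ, MvPolynomial.aeval θ (Polynomial.aeval y Bq) =
      Polynomial.aeval (θ (Sum.inl 1)) B := fun θ => by rw [hy, hBq, mvAeval_aeval_X_map]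
  have evA' : ∀ θ : Fin 2 ⊕ Fin 2 → ℂ, MvPolynomial.aeval θ (Polynomial.aeval y (derivative Aq)) =
      Polynomial.aeval (θ (Sum.inl 1)) (derivative A) := fun θ => by
    rw [hy, hAq, Polynomial.derivative_map, mvAeval_aeval_X_map]
  have evB' : ∀ θ : Fin 2 ⊕ Fin 2 → ℂ, MvPolynomial.aeval θ (Polynomial.aeval y (derivative Bq)) =
      Polynomial.aeval (θ (Sum.inl 1)) (derivative B) := fun θ => by
    rw [hy, hBq, Polynomial.derivative_map, mvAeval_aeval_X_map]
  refine ⟨![MvPolynomial.X (Sum.inl 0) - 1,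
    Polynomial.aeval y Aq * MvPolynomial.X (Sum.inr 1) - Polynomial.aeval y Bq], ?_, ?_⟩
  · intro i
    fin_cases i
    · simp
    · simp [evA, evB, hx]
  · rw [Matrix.det_fin_two]
    simp [Matrix.of_apply, Derivation.leibniz, Derivation.map_aeval, MvPolynomial.pderiv_X, hpd,
      evA, evA', evB']
    intro h
    apply hJ
    linear_combination h

end Summit.Schanuel.Schanuel.Cruxes.KhovanskiiApproxTypeEv.LambertLiouvilleKill

end
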